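import Summits.Langlands.Langlands.Theses.OrdinaryPrimeTransport
import Literature.NumberTheory.DiophantineGeometry.BcgpResiduallyA5bModular
import Literature.NumberTheory.Automorphic.IsAutomorphicAE
import Literature.NumberTheory.Automorphic.FreitasLeHungSiksekAbelianVariety
import HarnessLib

/-!
# Line `GL2TypeSurfaceRealQuadratic` — crux `ReciprocityUpToIrreducibility` (item stmt-Langlands-14328; routes
`IrreducibilityBySelfDuality` (primary decl) and `OrdinaryPrimeTransport` (its `Iff.rfl`-equal copy)); G4 ladder-down generation 27

DIAL θ29 = the DIMENSION `g = dim A = [E:ℚ]` of GL₂-TYPE abelian varieties over REAL QUADRATIC fields, inside clause (B) at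
`n = 2`.  Family `GL2TypeModularRealQuadratic g`: for every real quadratic `K`, every GL₂-type `A/K` of dimension `g`
(`IsGL2Type`: a number field `E`, `[E:ℚ] = dim A`, `E →+* End⁰_K(A)`), every framed dual `r` of `V_ℓ(A)` (`IsFramedDualTate`, the
BCGP clause) and every IRREDUCIBLE, a.e.-unramified, de Rham `ρ : Γ_K → GL₂(ℚ̄_ℓ)` that is an a.e. Frobenius factor of `r`
(`IsFrobFactorAE`; the `λ`-adic pieces of `H¹`), `ρ` is automorphic on `GL₂(𝔸_K)` in the summit's a.e. Satake form.
* `g = 1` = THE FLOOR: Freitas–Le Hung–Siksek 2015 Thm. 1 (elliptic curves over real quadratic fields are modular), the in-tree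
  named fact `Literature.NumberTheory.Automorphic.fls2015_modular_abelianVariety_dimOne_realQuadratic` (abelian-variety / `GL₂`
  form, vendored by this unit, p205662) ⇒ `floor_one` (sorry-free transport `satakeFrobCompatibleAE_of_isFrobFactorAE`);
* `g = 2` = THE RUNG `GL2TypeSurfaceRealQuadratic` (GL₂-type abelian SURFACES over real quadratic fields — open in print:
  "potentially modular" only, BCGP 2021 p. 5; instance-wise results of Dembélé–Kumar);
* `g ≥ 3` = `GL2TypeHigherRealQuadratic`.
Skeleton: five registered stubs over five NAMED obligation nodes (`FloorText`, `GL2TypeSurfaceRealQuadratic`,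
`GL2TypeHigherRealQuadratic`, `SectorMergeStep`, `OffSectorReciprocity`; the `@[stub]` tag lines are comments — crux workfiles do
not carry gate-reserved attributes): `stub_floorFact`, `stub_rung`, `stub_higher`, `stub_sectorMerge`, `stub_offSector`; the
composition `ReciprocityUpToIrreducibility_of` concludes the crux decl BY NAME with no `sorry` outside the stubs — in this
PUBLISHED copy the `Iff.rfl`-equal decl `Summit.Langlands.Langlands.Theses.OrdinaryPrimeTransport.ReciprocityUpToIrreducibility`
(the crux-workfile farm path cannot serve the `IrreducibilityBySelfDuality` module: "remote:incoherent … mismatch", as for g25/g26),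
in the seat's REGISTRATION copy (`ledger skeleton check`, same text with both route modules imported) the primary decl
`Summit.Langlands.Langlands.Theses.IrreducibilityBySelfDuality.ReciprocityUpToIrreducibility` plus this copy as `…_opt_of`; `by_cases` on the sector `InGL2TypeSector` exactly as the lines
`A5bTwoRankOne` / `AsaiGL3`.  On-path (`Langlands → rung`, `E → rung`) in §6 and in `Lines/GL2TypeSurfaceRealQuadratic_onpath.lean`;
F3 witness in `Lines/GL2TypeSurfaceRealQuadratic_special.lean`; card `Lines/GL2TypeSurfaceRealQuadratic.md`; ladder
`LADDER-GL2TypeSurfaceRealQuadratic.md`.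
-/

noncomputable section

set_option linter.dupNamespace false

open scoped MatrixGroups Matrix NumberField Classical
open Filter IsDedekindDomain IsDedekindDomain.HeightOneSpectrum CategoryTheory
open Literature.NumberTheory.Automorphic Literature.NumberTheory.GaloisRepresentations
open Literature.NumberTheory.PAdicHodge Literature.NumberTheory.DiophantineGeometry
open Literature.AlgebraicGeometry.Motives (AbelianVariety)
open NumberField
open Summit.Langlands

namespace Summit.Langlands.Langlands.Cruxes.ReciprocityUpToIrreducibility.GL2TypeSurfaceRealQuadratic

/-! ## 0. The floor fact = `Literature.NumberTheory.Automorphic.fls2015_modular_abelianVariety_dimOne_realQuadratic`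
(FLS 2015 Thm. 1 in abelian-variety / `GL₂` a.e.-Satake form; vendored p205662, commit 2a50369dd387). -/

/-! ## 1. Vocabulary: framed duals of Tate modules, GL₂-type, Frobenius-factor, the family -/

/-- `r` is the framed dual of `V_ℓ(A)` in the dual basis of `b` (verbatim the clause of the BCGP / FLS facts):
`r(γ) = [γ⁻¹]_bᵀ`, i.e. `H¹_ét(A_{K̄}, ℚ_ℓ) ⊗ ℚ̄_ℓ` framed. -/
def IsFramedDualTate {K : Type} [Field K] [NumberField K] (A : AbelianVariety K) (ℓ : ℕ) [Fact ℓ.Prime]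
    {m : ℕ} (b : Module.Basis (Fin m) ℚ_[ℓ] (A.rationalTateModule ℓ))
    (r : FramedGaloisRep K (PadicAlgCl ℓ) m) : Prop :=
  ∀ g : Field.absoluteGaloisGroup K,
    (r g).val = ((LinearMap.toMatrix b b (A.rationalTateRep ℓ g⁻¹)).map (algebraMap ℚ_[ℓ] (PadicAlgCl ℓ))).transpose

/-- **`A` is of GL₂-type** (Ribet): a number field `E` with `[E:ℚ] = dim A` acts on `A` by `K`-rational
endomorphisms (`E →+* End⁰(A) = A.endAlgebra`). At `dim A = 1` take `E = ℚ`. -/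
def IsGL2Type {K : Type} [Field K] (A : AbelianVariety K) : Prop :=
  ∃ (E : Type) (_ : Field E) (_ : NumberField E), Module.finrank ℚ E = A.dim ∧ Nonempty (E →+* A.endAlgebra)

/-- **`ρ` is an a.e. Frobenius factor of `r`**: at all but finitely many places, the characteristic polynomial of
every arithmetic Frobenius under `ρ` divides the one under `r` (for `ρ = ρ_{A,λ}^∨` a `λ`-adic constituent of
`H¹(A) ⊗ ℚ̄_ℓ` this holds at every good place). -/
def IsFrobFactorAE {K : Type} [Field K] [NumberField K] {ℓ : ℕ} [Fact ℓ.Prime] {n m : ℕ}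
    (ρ : FramedGaloisRep K (PadicAlgCl ℓ) n) (r : FramedGaloisRep K (PadicAlgCl ℓ) m) : Prop :=
  ∀ᶠ v : HeightOneSpectrum (𝓞 K) in cofinite, ∀ 𝔓 ∈ v.primesAbove, ∀ σ : Field.absoluteGaloisGroup K,
    IsArithFrobAt (𝓞 K) σ 𝔓 → FramedRep.charpoly ρ σ ∣ FramedRep.charpoly r σ

/-- **THE RUNG FAMILY, dial = `g = dim A = [E:ℚ]`.**  For every real quadratic field `K`, every GL₂-type abelian
variety `A/K` of dimension `g`, every prime `ℓ`, framed dual `r` of `V_ℓ(A)` and every irreducible, a.e.-unramified,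
de Rham (for Fontaine's pinned datum) `2`-dimensional `ρ : Γ_K → GL₂(ℚ̄_ℓ)` which is an a.e. Frobenius factor of `r`,
`ρ` is automorphic in the summit's a.e.-Satake form: some automorphic `π` of `GL₂(𝔸_K)` has Satake parameters matching
`det(X − ρ(Frob_v))` at almost all `v`. -/
def GL2TypeModularRealQuadratic (g : ℕ) : Prop :=
  ∀ (K : Type) [Field K] [NumberField K] [IsTotallyReal K], Module.finrank ℚ K = 2 →
    ∀ (A : AbelianVariety K), A.dim = g → IsGL2Type A →
      ∀ (ℓ : ℕ) [Fact ℓ.Prime] (b : Module.Basis (Fin (2 * g)) ℚ_[ℓ] (A.rationalTateModule ℓ))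
        (r : FramedGaloisRep K (PadicAlgCl ℓ) (2 * g)), IsFramedDualTate A ℓ b r →
        ∀ ρ : FramedGaloisRep K (PadicAlgCl ℓ) 2, ρ.toGaloisRep.IsIrreducible →
          (∀ᶠ v : HeightOneSpectrum (𝓞 K) in cofinite, ρ.IsUnramifiedAt v) →
          (∀ (w : HeightOneSpectrum (𝓞 K)) (hw : ((ℓ : ℕ) : 𝓞 K) ∈ w.asIdeal),
              (fontainePstAdicCompletion w ℓ hw).IsDeRhamFramed (ρ.toLocal w)) →
          IsFrobFactorAE ρ r →
          ∀ (hcpt : isCompact_glFiniteIntegralLevel 2 K) (ι : PadicAlgCl ℓ ≃+* ℂ),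
            ∃ π : AutomorphicRepData (AutomorphyDatum.gl 2 K hcpt), SatakeFrobCompatibleAE ι π ρ

/-- **THE RUNG (θ29 = 2)**: GL₂-type abelian SURFACES over real quadratic fields. -/
-- @[stub "GL2TypeSurfaceRealQuadratic"]
def GL2TypeSurfaceRealQuadratic : Prop := GL2TypeModularRealQuadratic 2

/-- **Above the rung (θ29 ≥ 3)**: GL₂-type abelian varieties of every dimension `≥ 3` over real quadratic fields. -/
-- @[stub "GL2TypeSurfaceRealQuadratic"]
def GL2TypeHigherRealQuadratic : Prop := ∀ g : ℕ, 3 ≤ g → GL2TypeModularRealQuadratic g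

/-- **Floor text** (obligation node): the member `g = 1` as the in-tree named fact — Freitas–Le Hung–Siksek 2015, Thm. 1,
in abelian-variety / `GL₂` a.e.-Satake form (`Literature.NumberTheory.Automorphic.fls2015_modular_abelianVariety_dimOne_realQuadratic`,
p205662; in print, XL to discharge in the tree). [cite: FreitasLeHungSiksek2015, Thm. 1] -/
-- @[stub "GL2TypeSurfaceRealQuadratic"]
def FloorText : Prop := fls2015_modular_abelianVariety_dimOne_realQuadratic

/-! ## 2. The floor `g = 1` from the fact; `g = 0` vacuous; the family from its members (sorry-free) -/

/-- Transport of the a.e.-Satake clause along an a.e. Frobenius factor of the SAME rank: the two monic degree-`n`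
characteristic polynomials coincide. -/
theorem satakeFrobCompatibleAE_of_isFrobFactorAE {K : Type} [Field K] [NumberField K] {ℓ : ℕ} [Fact ℓ.Prime]
    {n : ℕ} {hcpt : isCompact_glFiniteIntegralLevel n K} (ι : PadicAlgCl ℓ ≃+* ℂ)
    (π : AutomorphicRepData (AutomorphyDatum.gl n K hcpt)) (ρ r : FramedGaloisRep K (PadicAlgCl ℓ) n)
    (hunr : ∀ᶠ v : HeightOneSpectrum (𝓞 K) in cofinite, ρ.IsUnramifiedAt v) (hfac : IsFrobFactorAE ρ r)
    (hr : SatakeFrobCompatibleAE ι π r) : SatakeFrobCompatibleAE ι π ρ := by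
  filter_upwards [hunr, hfac, hr] with v hv hdvd hv3
  obtain ⟨a, ha, -, hchar⟩ := hv3
  refine ⟨a, ha, hv, fun 𝔓 h𝔓 σ hσ => ?_⟩
  have hrσ : FramedRep.charpoly r σ = arithFrobPolyOfSatake ι v.residueCard 1 a := hchar 𝔓 h𝔓 σ hσ
  have hd : FramedRep.charpoly ρ σ ∣ FramedRep.charpoly r σ := hdvd 𝔓 h𝔓 σ hσ
  have hmρ : (FramedRep.charpoly ρ σ).Monic := Matrix.charpoly_monic _
  have hmr : (FramedRep.charpoly r σ).Monic := Matrix.charpoly_monic _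
  have hdeg : (FramedRep.charpoly r σ).natDegree ≤ (FramedRep.charpoly ρ σ).natDegree := by
    simp only [FramedRep.charpoly, Matrix.charpoly_natDegree_eq_dim, Fintype.card_fin, le_refl]
  rw [← hrσ]
  exact (Polynomial.eq_of_monic_of_dvd_of_natDegree_le hmρ hmr hd hdeg).symm

/-- **F3: the family at `g = 1` from the floor fact** (FLS 2015 Thm. 1, AV form): a one-dimensional abelian variety
needs no `E` (the hypothesis `IsGL2Type` is discarded), `r` is `2`-dimensional, and the a.e.-Satake clause passes from
`r` to its rank-`2` Frobenius factor `ρ`. -/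
theorem floor_one (h : fls2015_modular_abelianVariety_dimOne_realQuadratic) : GL2TypeModularRealQuadratic 1 := by
  intro K _ _ _ hK A hdim _hGL ℓ _ b r hfr ρ _hirr hunr _hdR hfac hcpt ι
  obtain ⟨π, -, hπ⟩ := h K hK A hdim ℓ b r hfr hcpt ι
  exact ⟨π.1, satakeFrobCompatibleAE_of_isFrobFactorAE ι π.1 ρ r hunr hfac hπ⟩

/-- **Every member** from the floor fact, the rung and the higher members (`g = 0` is covered by `g ≥ 3`? no —
`g = 0` is handled directly: it is implied by nothing and needed by nothing, so the merge quantifies over `1 ≤ g`). -/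
theorem family_of (h1 : FloorText) (h2 : GL2TypeSurfaceRealQuadratic) (h3 : GL2TypeHigherRealQuadratic)
    (g : ℕ) (hg : 1 ≤ g) : GL2TypeModularRealQuadratic g := by
  rcases Nat.lt_or_ge g 3 with h | h
  · interval_cases g
    · exact floor_one h1
    · exact h2
  · exact h3 g h

/-! ## 3. The sector of clause (B), the merge target, the off-sector complement -/

/-- **The GL₂-type real-quadratic sector of clause (B)** at `(K, ℓ, n, ρ)`: `n = 2`, `K` totally real quadratic, and
`ρ` is an a.e. Frobenius factor of a framed dual of `V_ℓ(A)` for some GL₂-type `A/K` of dimension `g ≥ 1`. -/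
def InGL2TypeSector (K : Type) [Field K] [NumberField K] (ℓ : ℕ) [Fact ℓ.Prime] {n : ℕ}
    (ρ : FramedGaloisRep K (PadicAlgCl ℓ) n) : Prop :=
  ∃ hn : n = 2, IsTotallyReal K ∧ Module.finrank ℚ K = 2 ∧
    ∃ (A : AbelianVariety K) (g : ℕ), 1 ≤ g ∧ A.dim = g ∧ IsGL2Type A ∧
      ∃ (b : Module.Basis (Fin (2 * g)) ℚ_[ℓ] (A.rationalTateModule ℓ)) (r : FramedGaloisRep K (PadicAlgCl ℓ) (2 * g)),
        IsFramedDualTate A ℓ b r ∧ IsFrobFactorAE (hn ▸ ρ) r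

/-- **Merge target**: clause (B) of E VERBATIM (cuspidal, `L`-algebraic, `Corresponds Rec ι π ρ`) for EVERY
reciprocity datum `Rec`, on the GL₂-type real-quadratic sector. -/
def SectorGaloisToAutomorphic : Prop :=
  ∀ (F : Type) [Field F] [NumberField F] (Rec : ReciprocityData F) (n : ℕ), 0 < n →
    ∀ (hcpt : isCompact_glFiniteIntegralLevel n F) (ℓ : ℕ) [Fact ℓ.Prime] (ι : PadicAlgCl ℓ ≃+* ℂ)
      (ρ : FramedGaloisRep F (PadicAlgCl ℓ) n),
      ρ.toGaloisRep.IsIrreducible → IsGeometricFramed Rec ρ → InGL2TypeSector F ℓ ρ →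
        ∃ π : CuspidalAutomorphicRepData n F hcpt, π.1.IsLAlgebraic ∧ Corresponds Rec ι π.1 ρ

/-- **The off-sector complement**: E with clause (A) entire and clause (B) restricted OFF the sector. -/
-- @[stub "GL2TypeSurfaceRealQuadratic"]
def OffSectorReciprocity : Prop :=
  ∀ (F : Type) [Field F] [NumberField F], ∃ Rec : ReciprocityData F, ∀ n : ℕ, 0 < n →
    ∀ hcpt : isCompact_glFiniteIntegralLevel n F,
      (∀ π : CuspidalAutomorphicRepData n F hcpt, π.1.IsLAlgebraic →
        ∀ (ℓ : ℕ) [Fact ℓ.Prime] (ι : PadicAlgCl ℓ ≃+* ℂ),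
          ∃ ρ : FramedGaloisRep F (PadicAlgCl ℓ) n, IsGeometricFramed Rec ρ ∧ Corresponds Rec ι π.1 ρ) ∧
      (∀ (ℓ : ℕ) [Fact ℓ.Prime] (ι : PadicAlgCl ℓ ≃+* ℂ) (ρ : FramedGaloisRep F (PadicAlgCl ℓ) n),
        ρ.toGaloisRep.IsIrreducible → IsGeometricFramed Rec ρ → ¬ InGL2TypeSector F ℓ ρ →
          ∃ π : CuspidalAutomorphicRepData n F hcpt, π.1.IsLAlgebraic ∧ Corresponds Rec ι π.1 ρ)

/-- **Sector-merge step** (obligation node): from a.e.-Satake automorphy of EVERY member of the family (`g ≥ 1`) to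
clause (B) of E verbatim on the GL₂-type sector, for every reciprocity datum `Rec`. -/
-- @[stub "GL2TypeSurfaceRealQuadratic"]
def SectorMergeStep : Prop := (∀ g : ℕ, 1 ≤ g → GL2TypeModularRealQuadratic g) → SectorGaloisToAutomorphic

/-! ## 4. The five registered stubs -/

/-- The FLOOR as a named fact: FLS 2015 Thm. 1 in AV form (in print; XL to discharge). -/
theorem stub_floorFact : FloorText := by
  sorry

/-- **THE RUNG (open core)**: GL₂-type abelian surfaces over real quadratic fields. -/
theorem stub_rung : GL2TypeSurfaceRealQuadratic := by
  sorry

/-- The members above the rung (`g ≥ 3`). -/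
theorem stub_higher : GL2TypeHigherRealQuadratic := by
  sorry

/-- Sector merge: from a.e.-automorphy of every member to clause (B) of E verbatim on the sector, for every `Rec`
(strong multiplicity one and Jacquet–Shalika ⇒ the `π` is cuspidal `L`-algebraic; local–global compatibility at
every place: Carayol / Blasius–Rogawski–Taylor / Skinner / T. Liu for Hilbert modular forms). -/
theorem stub_sectorMerge : SectorMergeStep := by
  sorry

/-- E with clause (B) restricted OFF the sector (the honest complement). -/
theorem stub_offSector : OffSectorReciprocity := by
  sorry

/-! ## 5. Composition (no sorry below this line) -/

/-- **SKELETON THEOREM — the crux BY NAME from the five REGISTERED stubs, used by name** (audit: proof-of-item modulo the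
five sorries; this is the theorem `ledger skeleton check` registers).  `Rec` and clause (A) come from the off-sector stub;
clause (B) is a case split on the GL₂-type sector `InGL2TypeSector`. -/
theorem reciprocityUpToIrreducibility_of_stubs :
    Summit.Langlands.Langlands.Theses.OrdinaryPrimeTransport.ReciprocityUpToIrreducibility := by
  intro F _ _
  obtain ⟨Rec, hall⟩ := stub_offSector F
  refine ⟨Rec, fun n hn hcpt => ⟨(hall n hn hcpt).1, ?_⟩⟩
  intro ℓ _ ι ρ hirr hgeo
  by_cases hsec : InGL2TypeSector F ℓ ρ
  · exact stub_sectorMerge (family_of stub_floorFact stub_rung stub_higher) F Rec n hn hcpt ℓ ι ρ hirr hgeo hsec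
  · exact (hall n hn hcpt).2 ℓ ι ρ hirr hgeo hsec

/-- **COMPOSITION, hypothesis form — the crux BY NAME from the five stub STATEMENTS** (sorry-free; the same eight lines with
the stubs as hypotheses, for provers who close the stubs elsewhere). -/
theorem ReciprocityUpToIrreducibility_of :
    FloorText → GL2TypeSurfaceRealQuadratic → GL2TypeHigherRealQuadratic → SectorMergeStep → OffSectorReciprocity →
    Summit.Langlands.Langlands.Theses.OrdinaryPrimeTransport.ReciprocityUpToIrreducibility := by
  intro h1 h2 h3 hmerge hoff F _ _
  obtain ⟨Rec, hall⟩ := hoff F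
  refine ⟨Rec, fun n hn hcpt => ⟨(hall n hn hcpt).1, ?_⟩⟩
  intro ℓ _ ι ρ hirr hgeo
  by_cases hsec : InGL2TypeSector F ℓ ρ
  · exact hmerge (family_of h1 h2 h3) F Rec n hn hcpt ℓ ι ρ hirr hgeo hsec
  · exact (hall n hn hcpt).2 ℓ ι ρ hirr hgeo hsec

/-! ## 6. The rung is a consequence of the top and of the summit (sorry-free) -/

/-- `E → GL2TypeModularRealQuadratic g` for every `g`. -/
theorem gl2TypeModular_of_top (g : ℕ)
    (hE : Summit.Langlands.Langlands.Theses.OrdinaryPrimeTransport.ReciprocityUpToIrreducibility) :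
    GL2TypeModularRealQuadratic g := by
  intro K _ _ _ _hK A _hdim _hGL ℓ _ b r _hfr ρ hirr hunr hdR _hfac hcpt ι
  obtain ⟨Rec, hall⟩ := hE K
  have hB : GaloisToAutomorphic 2 Rec hcpt := (hall 2 (by norm_num) hcpt).2
  have hgeo : IsGeometricFramed Rec ρ := ⟨hunr, fun w hw => hdR w hw⟩
  obtain ⟨π, _hLalg, hcorr⟩ := hB ℓ ι ρ hirr hgeo
  exact ⟨π.1, hcorr.1⟩

/-- `E → rung`. -/
theorem GL2TypeSurfaceRealQuadratic_of_top
    (hE : Summit.Langlands.Langlands.Theses.OrdinaryPrimeTransport.ReciprocityUpToIrreducibility) :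
    GL2TypeSurfaceRealQuadratic :=
  gl2TypeModular_of_top 2 hE

/-- `Langlands → GL2TypeModularRealQuadratic g` for every `g` (the F4 on-path lemma). -/
theorem gl2TypeModular_of_langlands (g : ℕ) (hL : _root_.Langlands) : GL2TypeModularRealQuadratic g := by
  intro K _ _ _ _hK A _hdim _hGL ℓ _ b r _hfr ρ hirr hunr hdR _hfac hcpt ι
  obtain ⟨⟨Rec⟩, hall⟩ := hL K
  have hB : GaloisToAutomorphic 2 Rec hcpt := (hall Rec 2 (by norm_num) hcpt).2
  have hgeo : IsGeometricFramed Rec ρ := ⟨hunr, fun w hw => hdR w hw⟩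
  obtain ⟨π, _hLalg, hcorr⟩ := hB ℓ ι ρ hirr hgeo
  exact ⟨π.1, hcorr.1⟩

/-- **F4 on-path lemma**: `S → Rung`. -/
@[aesop safe apply]
theorem GL2TypeSurfaceRealQuadratic_of_Langlands (hL : _root_.Langlands) : GL2TypeSurfaceRealQuadratic :=
  gl2TypeModular_of_langlands 2 hL

/-- Both vendorings of FLS Thm. 1 are in scope (Weierstrass / trace form and abelian-variety / `GL₂` form). -/
example : Prop := FreitasLeHungSiksek2015_thm1 ∧ fls2015_modular_abelianVariety_dimOne_realQuadratic

end Summit.Langlands.Langlands.Cruxes.ReciprocityUpToIrreducibility.GL2TypeSurfaceRealQuadratic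

end
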